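import Mathlib
import HarnessLib.Audit
import Summits.PneNP.PneNP.Theorems.PstarFreshGateFive
import Summits.PneNP.PneNP.Theorems.PstarFreshGateTerminal

/-!
# Fresh gates on terminal cores: at most five outputs, raw-data form (ROUND-24, O2; targets `TerminalFiveA` / `TerminalFiveMaxSharing`)

FRONTIER range-avoidance ladder, rung F-N3, ROUND 24 (cell `pnp-ideate`, planner memo `r24/CORE-BOUND-NOTES.md` §10.1, §13.2; typed targets
`PstarCoreBoundTargets.TerminalFiveA` / `TerminalFiveMaxSharing` (p646951); restricted-model proof complexity — nothing here bears on `P` versus `NP`).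

`PstarFreshGateFive.card_le_five_of_freshGate` in the vocabulary of the typed targets (`PstarCoreBoundTargets.Terminal`), i.e. the landed
`PstarCoreBoundTargets.card_le_five_of_terminal'` (= `TerminalFiveA` with privates unread) with its hypothesis `hun` RELAXED by one fresh
isolated gate:

* `card_le_five_of_freshGate_terminal` — a terminal core with a maximal leaf-peelable `F ⊆ J₀` whose co-edges are chords (Assumption A, automatic
  below twelve outputs) and whose readers avoid the co-edge privates except for ONE fresh isolated gate `g₀ = (p, z)` on a co-edge `e₀`
  (`z` outside every output of `J₀`, outside `C₁ ∪ C₂`, in no other reader) has at most five outputs;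
* `card_le_five_of_maxSharing_gate` — the same at maximal sharing `2·#sharedSlots = #J₀`, where the freshness `z ∉ vars J₀` is automatic
  (`PstarMaxSharingReaders`); only the isolation of `z` and "no other private-touching reader" remain as hypotheses.
-/

set_option linter.dupNamespace false -- `Summit.PneNP.PneNP.…`: summit = sub-problem name (D-0017 single-conjunct layout)

open Finset Literature.Computability.Complexity
open Summit.PneNP.PneNP.Theorems.PstarTyped (Typed)
open Summit.PneNP.PneNP.Theorems.PstarSALevel (varSet bdry BoundaryExpanding SimpleOverlap)
open Summit.PneNP.PneNP.Theorems.PstarGapOneAll (gval)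
open Summit.PneNP.PneNP.Theorems.PstarCoreBound (XorClosed)
open Summit.PneNP.PneNP.Theorems.PstarChordRepair (IsChord)
open Summit.PneNP.PneNP.Theorems.PstarChordBridgeTools (privs mem_privs vars_mem_privs)
open Summit.PneNP.PneNP.Theorems.PstarChordBridge
open Summit.PneNP.PneNP.Theorems.PstarChordBridgeCotree (Peelable)
open Summit.PneNP.PneNP.Theorems.PstarChordBridgeTerminal (HasConstraints)
open Summit.PneNP.PneNP.Theorems.PstarChordBridgeAssemble (exists_bridgeData)
open Summit.PneNP.PneNP.Theorems.PstarSharingBound (sharedSlots)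
open Summit.PneNP.PneNP.Theorems.PstarCoreBoundTargets (Terminal)
open Summit.PneNP.PneNP.Theorems.PstarFreshGateTools (FreshGate)
open Summit.PneNP.PneNP.Theorems.PstarFreshGateFive (card_le_five_of_freshGate)
open Summit.PneNP.PneNP.Theorems.PstarMaxSharingReaders (readers_of_maxSharing_union)

namespace Summit.PneNP.PneNP.Theorems.PstarFreshGateTerminalFive

variable {n m : ℕ}

/-- **A terminal core with Assumption A and one fresh isolated gate has at most five outputs.**  See the module docstring. -/
theorem card_le_five_of_freshGate_terminal (I : LocalMap 4 n m) (hI : I.IsPure xorAndPred) (hT : Typed I) (hS : SimpleOverlap I) {r : ℕ}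
    (hB : BoundaryExpanding r I) {y : Fin m → Bool} {J₀ : Finset (Fin m)} {w₁ w₂ : Finset (Fin n) × Finset (Fin m) × Bool}
    (h : Terminal I r y J₀ w₁ w₂) {F : Finset (Fin m)} (hF : F ⊆ J₀) (hP : Peelable I F)
    (hmax : ∀ F', F ⊆ F' → F' ⊆ J₀ → Peelable I F' → F' = F) (hchord : ∀ e ∈ J₀ \ F, IsChord I J₀ e)
    {e₀ g₀ : Fin m} {s₀ : Fin 4} {z : Fin n} (he₀ : e₀ ∈ J₀ \ F) (hs₀ : 2 ≤ s₀.val) (hg₀ : g₀ ∈ w₁.2.1 ∪ w₂.2.1)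
    (hpair : (I.vars g₀ 2 = I.vars e₀ s₀ ∧ I.vars g₀ 3 = z) ∨ (I.vars g₀ 2 = z ∧ I.vars g₀ 3 = I.vars e₀ s₀))
    (hzJ : ∀ j ∈ J₀, z ∉ varSet I j) (hzC : z ∉ w₁.1 ∧ z ∉ w₂.1)
    (hzG : ∀ g ∈ w₁.2.1 ∪ w₂.2.1, g ≠ g₀ → I.vars g 2 ≠ z ∧ I.vars g 3 ≠ z)
    (hun : ∀ g ∈ w₁.2.1 ∪ w₂.2.1, g ≠ g₀ → ∀ v ∈ privs I (J₀ \ F), I.vars g 2 ≠ v ∧ I.vars g 3 ≠ v) : J₀.card ≤ 5 := by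
  classical
  obtain ⟨hne, hX, hJr, hG₁, hG₂, hr, hT3, hM0⟩ := h
  have hzp : z ∉ privs I (J₀ \ F) := by
    rw [mem_privs]
    rintro ⟨e, he, hz | hz⟩
    · exact hzJ e (mem_sdiff.1 he).1 (hz ▸ PstarCentreFree.vars_mem_varSet I e 2)
    · exact hzJ e (mem_sdiff.1 he).1 (hz ▸ PstarCentreFree.vars_mem_varSet I e 3)
  have hcross : ∀ g ∈ w₁.2.1 ∪ w₂.2.1, ¬ (I.vars g 2 ∈ privs I (J₀ \ F) ∧ I.vars g 3 ∈ privs I (J₀ \ F)) := by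
    intro g hg ⟨h2, h3⟩
    by_cases hgg : g = g₀
    · subst hgg
      rcases hpair with ⟨-, h3z⟩ | ⟨h2z, -⟩
      · exact hzp (h3z ▸ h3)
      · exact hzp (h2z ▸ h2)
    · exact (hun g hg hgg _ h2).1 rfl
  obtain ⟨B, hy, hJ, hN, ⟨h1, h2, h3, h4, h5, h6⟩, hW, hL, -, -⟩ :=
    exists_bridgeData I hI hT hS hB y hne hJr.le w₁ w₂ hG₁ hG₂ hT3 hM0 hF hP hmax hchord hcross
  have hsol : ∀ K zz, Solution I B K zz ↔
      (∀ j ∈ K, I.eval zz j = y j) ∧ gval I w₁.1 w₁.2.1 zz = w₁.2.2 ∧ gval I w₂.1 w₂.2.1 zz = w₂.2.2 := by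
    intro K zz; unfold Solution; rw [hy, h1, h2, h3, h4, h5, h6]
  have hfg : FreshGate I B e₀ g₀ s₀ z :=
    { he₀ := by rw [hN]; exact he₀
      hs₀ := hs₀
      hg₀ := by rw [h2, h5]; exact hg₀
      hpair := hpair
      hzJ := by rw [hJ]; exact hzJ
      hzC := by rw [h1, h4]; exact hzC
      hzG := by rw [h2, h5]; exact hzG
      hun := by rw [h2, h5, hN]; exact hun }
  have hPB : Peelable I (B.J₀ \ B.N) := by rw [hJ, hN, Finset.sdiff_sdiff_eq_self hF]; exact hP
  rw [← hJ]
  refine card_le_five_of_freshGate I hI hT hS hB hW (by rw [hJ]; exact hJr) (by rw [hJ, h2, h5]; exact hr) (by rw [hJ]; exact hX)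
    hPB (by rw [h2, hJ]; exact hG₁.symm) (by rw [h5, hJ]; exact hG₂.symm) hL ?_ (fun f hf => ?_) hfg
  · rintro ⟨zz, hzz⟩
    rw [hJ] at hzz
    exact hT3 ⟨zz, (hsol J₀ zz).1 hzz⟩
  · obtain ⟨zz, hzz⟩ := hM0 f (by rw [hJ] at hf; exact hf)
    exact ⟨zz, by rw [hJ]; exact (hsol _ zz).2 hzz⟩

/-- **At maximal sharing: a terminal core with Assumption A and one isolated gate has at most five outputs** (freshness of the partner is
automatic by `PstarMaxSharingReaders.readers_of_maxSharing_union`). -/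
theorem card_le_five_of_maxSharing_gate (I : LocalMap 4 n m) (hI : I.IsPure xorAndPred) (hT : Typed I) (hS : SimpleOverlap I) {r : ℕ}
    (hB : BoundaryExpanding r I) {y : Fin m → Bool} {J₀ : Finset (Fin m)} {w₁ w₂ : Finset (Fin n) × Finset (Fin m) × Bool}
    (h : Terminal I r y J₀ w₁ w₂) (hms : 2 * (sharedSlots I J₀).card = J₀.card) {F : Finset (Fin m)} (hF : F ⊆ J₀) (hP : Peelable I F)
    (hmax : ∀ F', F ⊆ F' → F' ⊆ J₀ → Peelable I F' → F' = F) (hchord : ∀ e ∈ J₀ \ F, IsChord I J₀ e)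
    {e₀ g₀ : Fin m} {s₀ : Fin 4} (he₀ : e₀ ∈ J₀ \ F) (hs₀ : 2 ≤ s₀.val) (hg₀ : g₀ ∈ w₁.2.1 ∪ w₂.2.1)
    {t₀ t₁ : Fin 4} (ht₀ : 2 ≤ t₀.val) (ht₁ : 2 ≤ t₁.val) (htt : t₀ ≠ t₁) (hgp : I.vars g₀ t₀ = I.vars e₀ s₀)
    (hzC : I.vars g₀ t₁ ∉ w₁.1 ∧ I.vars g₀ t₁ ∉ w₂.1)
    (hzG : ∀ g ∈ w₁.2.1 ∪ w₂.2.1, g ≠ g₀ → I.vars g 2 ≠ I.vars g₀ t₁ ∧ I.vars g 3 ≠ I.vars g₀ t₁)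
    (hun : ∀ g ∈ w₁.2.1 ∪ w₂.2.1, g ≠ g₀ → ∀ v ∈ privs I (J₀ \ F), I.vars g 2 ≠ v ∧ I.vars g 3 ≠ v) : J₀.card ≤ 5 := by
  classical
  obtain ⟨-, -, hfresh⟩ := readers_of_maxSharing_union I hB h.2.1 hms hchord h.2.2.2.1.symm h.2.2.2.2.1.symm h.2.2.2.2.2.1
  have hp : I.vars g₀ t₀ ∈ privs I (J₀ \ F) := hgp ▸ vars_mem_privs I he₀ hs₀
  have hzJ : ∀ j ∈ J₀, I.vars g₀ t₁ ∉ varSet I j := hfresh g₀ hg₀ t₀ t₁ ht₀ ht₁ htt hp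
  have hpair : (I.vars g₀ 2 = I.vars e₀ s₀ ∧ I.vars g₀ 3 = I.vars g₀ t₁) ∨ (I.vars g₀ 2 = I.vars g₀ t₁ ∧ I.vars g₀ 3 = I.vars e₀ s₀) := by
    rcases PstarMaxSharingReaders.and_slots ht₀ ht₁ htt with ⟨h0, h1⟩ | ⟨h0, h1⟩ <;> subst h0 <;> subst h1
    · exact Or.inl ⟨hgp, rfl⟩
    · exact Or.inr ⟨rfl, hgp⟩
  exact card_le_five_of_freshGate_terminal I hI hT hS hB h hF hP hmax hchord he₀ hs₀ hg₀ hpair hzJ hzC hzG hun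

end Summit.PneNP.PneNP.Theorems.PstarFreshGateTerminalFive
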